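import Summits.BirchSwinnertonDyer.BirchSwinnertonDyer.Theorems.Rank2ObservatoryQuadField769Places
import HarnessLib

/-!
# BirchSwinnertonDyer — rank ≥ 2 observatory: the split place `5` of `ℚ(√769)` (ℤ/2-torsion rows `392190n1/k1`)

HONEST FRAMING: per-curve certified theorems and census instruments; no claim on BSD in rank ≥ 2.

Row-independent data of the successor instrument KERNEL-2DESC-Z2 at the prime `5`, which splits in
`K = ℚ(ω)`, `ω² = ω + 192` (`…QuadField769`): the two residue maps `𝓞 K → ℤ/5` (`ω ↦ 4`, `ω ↦ 2`),
the generators `π₅ = 12911 + 966ω`, `π₅' = −13877 + 966ω` of norm `−5` with `5 = π₅ π₅'`, the two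
`SplitPrime` packages `P54`, `P52` (`…Z2SplitOdd`) with kernel certificates, their residue formulas on
`MonicQuad.lin`, and the correction bits `c = qrOf (res π') = 1` at both. Used by the refined odd
clause (`…Z2OddCaseRefined.oddClauseR_sound`) of the row files `392190n1/k1`, whose cover count needs
the places `{∞, 2, 3, 5}`. Sorry-free; axioms `propext`, `Classical.choice`, `Quot.sound`.
[cite: Cassels1991LecturesEllipticCurves, §15]
-/

-- single-conjunct summit: `Summit.BirchSwinnertonDyer.BirchSwinnertonDyer.…` repeats the name by design
set_option linter.dupNamespace false

noncomputable section

open scoped NumberField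

open Polynomial Module NumberField

namespace Summit.BirchSwinnertonDyer.BirchSwinnertonDyer.Rank2Observatory.TwoDescZ2

namespace QuadField769

/-- `5` is prime (instance for `ZMod 5`, `SplitPrime _ 5`). -/
instance fact_prime_five : Fact (Nat.Prime 5) := ⟨by norm_num⟩

/-! ## Residue maps at `5` -/

/-- A ring hom `ψ : 𝓞 K →+* ZMod 5` with `ψ θ = 4` exists (`4` is a root of the minimal polynomial of `θ` mod `5`). [folklore] -/
theorem exists_psi5_4 : ∃ ψ : 𝓞 (QuadField (-1) (-192)) →+* ZMod 5, ψ (MonicQuad.thetaInt aeval_ω) = 4 :=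
  MonicQuad.exists_ringHom_of_root irreducible aeval_ω finrank_eq hsq (4 : ZMod 5) (by decide)

/-- A ring hom `ψ : 𝓞 K →+* ZMod 5` with `ψ θ = 2` exists (`2` is a root of the minimal polynomial of `θ` mod `5`). [folklore] -/
theorem exists_psi5_2 : ∃ ψ : 𝓞 (QuadField (-1) (-192)) →+* ZMod 5, ψ (MonicQuad.thetaInt aeval_ω) = 2 :=
  MonicQuad.exists_ringHom_of_root irreducible aeval_ω finrank_eq hsq (2 : ZMod 5) (by decide)

/-- `res₅⁴ : ω ↦ 4 (mod 5)`. -/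
def res54 : 𝓞 (QuadField (-1) (-192)) →+* ZMod 5 := exists_psi5_4.choose
/-- The residue map `res54` at `θ` (its defining property, by `choose_spec`). [folklore] -/
theorem res54_ω : res54 (MonicQuad.thetaInt aeval_ω) = 4 := exists_psi5_4.choose_spec
/-- `res₅² : ω ↦ 2 (mod 5)`. -/
def res52 : 𝓞 (QuadField (-1) (-192)) →+* ZMod 5 := exists_psi5_2.choose
/-- The residue map `res52` at `θ` (its defining property, by `choose_spec`). [folklore] -/
theorem res52_ω : res52 (MonicQuad.thetaInt aeval_ω) = 2 := exists_psi5_2.choose_spec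

/-! ## Generators at `5` -/

/-- `π₅ = 12911 + 966ω` (norm `−5`, `ω ≡ 4`). -/
def g54 : 𝓞 (QuadField (-1) (-192)) := MonicQuad.lin aeval_ω 12911 966
/-- `π₅' = −13877 + 966ω` (norm `−5`, `ω ≡ 2`). -/
def g52 : 𝓞 (QuadField (-1) (-192)) := MonicQuad.lin aeval_ω (-13877) 966

/-- The place generator `g54` is prime in `𝓞 K` (prime-norm certificate via `MonicQuad.lin_prime_of_prime`). [folklore] -/
theorem g54_prime : Prime g54 :=
  MonicQuad.lin_prime_of_prime irreducible aeval_ω finrank_eq 12911 966 (n := -5)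
    (by norm_num [MonicQuad.normForm]) (by norm_num)
/-- The place generator `g52` is prime in `𝓞 K` (prime-norm certificate via `MonicQuad.lin_prime_of_prime`). [folklore] -/
theorem g52_prime : Prime g52 :=
  MonicQuad.lin_prime_of_prime irreducible aeval_ω finrank_eq (-13877) 966 (n := -5)
    (by norm_num [MonicQuad.normForm]) (by norm_num)

/-- `5 = π₅ π₅'`. -/
theorem five_eq : ((5 : ℕ) : 𝓞 (QuadField (-1) (-192))) = g54 * g52 := by
  simp only [g54, g52, MonicQuad.lin]
  push_cast
  linear_combination (-(933156 : 𝓞 (QuadField (-1) (-192)))) * ωi_rel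

/-! ## Split data at `5` -/

/-- The prime `(5, ω − 4)`: `π = 12911 + 966ω`, `π' = −13877 + 966ω`, residue map `ω ↦ 4`. -/
def P54 : SplitPrime (𝓞 (QuadField (-1) (-192))) 5 where
  π := g54
  π' := g52
  res := res54
  hℓ := five_eq
  hπ := by rw [g54, MonicQuad.map_lin aeval_ω _ res54_ω]; decide
  hπ' := by rw [g52, MonicQuad.map_lin aeval_ω _ res54_ω]; decide
  hker := dvd_of_res_eq_zero res54 g54_prime (by rw [g54, MonicQuad.map_lin aeval_ω _ res54_ω]; decide)

/-- The prime `(5, ω − 2)`: `π = −13877 + 966ω`, `π' = 12911 + 966ω`, residue map `ω ↦ 2`. -/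
def P52 : SplitPrime (𝓞 (QuadField (-1) (-192))) 5 where
  π := g52
  π' := g54
  res := res52
  hℓ := by rw [mul_comm]; exact five_eq
  hπ := by rw [g52, MonicQuad.map_lin aeval_ω _ res52_ω]; decide
  hπ' := by rw [g54, MonicQuad.map_lin aeval_ω _ res52_ω]; decide
  hker := dvd_of_res_eq_zero res52 g52_prime (by rw [g52, MonicQuad.map_lin aeval_ω _ res52_ω]; decide)

/-- The residue map of the split-prime datum `P54` at `θ`. [folklore] -/
theorem P54_res_theta : P54.res (MonicQuad.thetaInt aeval_ω) = 4 := res54_ω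
/-- The residue map of the split-prime datum `P52` at `θ`. [folklore] -/
theorem P52_res_theta : P52.res (MonicQuad.thetaInt aeval_ω) = 2 := res52_ω
/-- The residue map of the split-prime datum `P54` on `p + qθ`. [folklore] -/
theorem P54_res_lin (p q : ℤ) : P54.res (MonicQuad.lin aeval_ω p q) = (p : ZMod 5) + (q : ZMod 5) * 4 :=
  MonicQuad.map_lin aeval_ω _ res54_ω p q
/-- The residue map of the split-prime datum `P52` on `p + qθ`. [folklore] -/
theorem P52_res_lin (p q : ℤ) : P52.res (MonicQuad.lin aeval_ω p q) = (p : ZMod 5) + (q : ZMod 5) * 2 :=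
  MonicQuad.map_lin aeval_ω _ res52_ω p q
/-- Correction bit at `(5, ω − 4)`: `res π' = −13877 + 966·4 ≡ 2`, a non-square. -/
theorem P54_c : qrOf (P54.res P54.π') = 1 := by
  rw [qrOf_eq_sqb, show P54.res P54.π' = 2 by
    rw [show P54.π' = g52 from rfl, g52, P54_res_lin]; decide]
  decide
/-- Correction bit at `(5, ω − 2)`: `res π' = 12911 + 966·2 ≡ 3`, a non-square. -/
theorem P52_c : qrOf (P52.res P52.π') = 1 := by
  rw [qrOf_eq_sqb, show P52.res P52.π' = 3 by
    rw [show P52.π' = g54 from rfl, g54, P52_res_lin]; decide]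
  decide

end QuadField769

end Summit.BirchSwinnertonDyer.BirchSwinnertonDyer.Rank2Observatory.TwoDescZ2

end
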